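import Summits.ResolutionOfSingularities.ResolutionOfSingularities.Theorems.HilbertSamuelEliminationSigmaMaxModificationsCorridor3WLadderIsoTailsTowerBaseChangeRationalPoints
import Summits.ResolutionOfSingularities.ResolutionOfSingularities.Theorems.HilbertSamuelEliminationSigmaMaxModificationsCorridor3WLadderIsoKernelAlgClosed
import HarnessLib

/-!
# [OURS · L1 W4.2] KERNEL CENSUS: OVER A PERFECT GROUND FIELD THE ISOLATED KERNEL IS K3-sep ALONE
# (K1 a theorem, (k2) empty, and K2-sep ⟸ K3-sep by res-L1-w42-stub-2's base-change route A — all three discharged at perfect origins)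

Crux chain w42 (`SigmaMaxModifications`, stmt-ResolutionOfSingularities-18506; conjunct `SigmaMaxModificationsCorridor3`, stmt-…-19249),
line `w_ladder`, registered stubs `stub_isoSepRecurrent` (K2-sep ∧ K3-sep) and `stub_isoInsepTower` ((k2)) of skeleton v8.8. Lead res-L1-w42-lead-1
(gen 6). Helper file `--supports stmt-ResolutionOfSingularities-19249`; kernel only (no definition, no named fact).

WHAT IS PROVED. `false_of_isIsoPointTower_over_perfectField_of_K3sep`: an isolated E3 point tower over a maximal origin whose origin stage is
separated, quasi-compact and locally of finite type over a PERFECT field `k` of characteristic `p` is impossible as soon as K3-sep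
(`IsoSepSatelliteRecurrentImpossible p 3`) holds — upgrading gen 5's `false_of_isIsoPointTower_over_perfectField_of_sepRecurrent` (p558348, which
needed K2-sep ∧ K3-sep) by res-L1-w42-stub-2's `IsoTailsHS.satelliteRecurrent_of_isIsoPointTower_of_separableSteps` (p568820: an isolated E3 point
tower whose residue fields are separable over `k` step by step is SATELLITE-RECURRENT, by base change to `k^sep` and K1). Over a perfect `k` every
residue field `κ(x_n)` is a finite, hence separable, extension and is itself perfect, so (i) all of stub-2's separability hypotheses hold, (ii) no
stage has an inseparable directrix (gen 5 `forall_not_isInsepStage_of_perfectField_origin`), and K3-sep applies to the satellite-recurrent tower.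
Hence `isoQuadraticTowerTerminates_over_perfectField_of_K3sep`-shaped census: on the class of perfect ground fields (finite fields, `𝔽̄_p`, …) the
registered rows `stub_isoSepRecurrent` / `stub_isoInsepTower` reduce to K3-sep ALONE; their remaining content beyond K3-sep (inseparable residue
jumps, inseparable-directrix stages) lives over IMPERFECT ground fields only.

HONEST FRAMING. OURS bookkeeping over tree theorems (K1 p546901; stub-2's route A p568820; gen 5 p545326/p558348). Nothing here is a statement of
H. Hironaka's manuscript [Hironaka2017] nor of [CossartJannsenSaito2020] / [CossartPiltant2009]. AI-written; AI review is weaker than expert review.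
References: V. Cossart, O. Piltant, J. Algebra 321 (2009), ch. 3 I.8.3 (ix), ch. 4 II.4 [CossartPiltant2009]; The Stacks Project, Tag 01TB
[StacksProject].
-/

noncomputable section

set_option linter.dupNamespace false

open CategoryTheory AlgebraicGeometry TopologicalSpace IsLocalRing
open Summit.ResolutionOfSingularities.ResolutionOfSingularities.Theorems.CampaignW42
open Summit.ResolutionOfSingularities.ResolutionOfSingularities.Theorems.SigmaMaxModificationsCorridor3
open Literature.AlgebraicGeometry.Resolution Literature.AlgebraicGeometry.CossartJannsenSaito2020
open Summit.ResolutionOfSingularities.ResolutionOfSingularities.Cruxes.SigmaMaxModifications.IdeasL1Idea2R4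
  (IsIsoPointTower IsoQuadraticTowerTerminates)

namespace Summit.ResolutionOfSingularities.ResolutionOfSingularities.Cruxes.SigmaMaxModifications.IdeasL1C5

universe u

variable {p : ℕ} {ν : ℕ → ℕ} {T : BlowupTower.{u}} {pt : ∀ n, T.X n}

/-- The residue field of a closed point of a scheme locally of finite type over a field `k` is an ALGEBRAIC (indeed integral) extension of `k`, for
the `k`-structure read off the structure morphism (`Spec κ(x) → Spec k` is finite: Stacks 01TB). [cite: StacksProject, Tag 01TB] -/
theorem isIntegral_preimage_fromSpecResidueField {X : Scheme.{u}} {k : Type u} [Field k] (f : X ⟶ Spec (.of k)) [LocallyOfFiniteType f]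
    {x : X} (hx : IsClosed ({x} : Set X)) :
    (Spec.preimage (X.fromSpecResidueField x ≫ f)).hom.IsIntegral := by
  have hfin : IsFinite (X.fromSpecResidueField x ≫ f) := by
    rw [isClosed_singleton_iff_isClosedImmersion] at hx
    rw [isFinite_iff_locallyOfFiniteType_of_jacobsonSpace]
    infer_instance
  change (Spec.preimage (X.fromSpecResidueField x ≫ f)).hom.IsIntegral
  rw [← IsIntegralHom.SpecMap_iff, Spec.map_preimage]
  infer_instance

/-- **OVER A PERFECT GROUND FIELD THE ISOLATED KERNEL IS K3-sep ALONE.** An isolated E3 point tower over a maximal origin of characteristic `p` at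
level `3`, whose origin stage is separated, quasi-compact and locally of finite type over a PERFECT field, is impossible as soon as
`IsoSepSatelliteRecurrentImpossible p 3` (K3-sep) holds: stub-2's base-change theorem (all residue steps separable — automatic over a perfect field)
makes the tower satellite-recurrent, no stage has an inseparable directrix (perfect residue fields), so K3-sep refutes it.
[cite: CossartPiltant2009, ch. 3 I.8.3 (ix), ch. 4 II.4] [cite: StacksProject, Tag 01TB] -/
theorem false_of_isIsoPointTower_over_perfectField_of_K3sep (h3 : IsoSepSatelliteRecurrentImpossible.{u} p 3)
    {k : Type u} [Field k] [CharP k p] [PerfectField k] (f : T.X 0 ⟶ Spec (.of k)) [IsSeparated f] [LocallyOfFiniteType f] [QuasiCompact f]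
    (hO : IsMaximalOrigin p 3 ν (T.X 0) (pt 0)) (hT : IsIsoPointTower 3 ν T pt) : False := by
  haveI := fun n => T.ln n
  -- the `k`-structure of `κ(x_0)` and its separability
  let φ₀ : CommRingCat.of k ⟶ (T.X 0).residueField (pt 0) := Spec.preimage ((T.X 0).fromSpecResidueField (pt 0) ≫ f)
  have hφ₀ : (T.X 0).fromSpecResidueField (pt 0) ≫ f = Spec.map φ₀ := (Spec.map_preimage _).symm
  have hsep₀ : letI := φ₀.hom.toAlgebra; Algebra.IsSeparable k ((T.X 0).residueField (pt 0)) := by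
    letI := φ₀.hom.toAlgebra
    haveI : Algebra.IsIntegral k ((T.X 0).residueField (pt 0)) := ⟨isIntegral_preimage_fromSpecResidueField f (hT.2.2.1 0)⟩
    exact Algebra.IsAlgebraic.isSeparable_of_perfectField
  -- every residue field of the tower is perfect, so every step is separable
  have hperf : ∀ n, PerfectField (ResidueField ((T.X n).presheaf.stalk (pt n))) :=
    perfectField_residueField_of_isIsoPointTower hT (perfectField_residueField_of_isClosed f (hT.2.2.1 0))
  have hsep : ∀ n, letI := ((T.π n).residueFieldMap (pt (n + 1))).hom.toAlgebra
      Algebra.IsSeparable ((T.X n).residueField ((T.π n).base (pt (n + 1)))) ((T.X (n + 1)).residueField (pt (n + 1))) := by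
    intro n
    letI := ((T.π n).residueFieldMap (pt (n + 1))).hom.toAlgebra
    haveI : Algebra.IsIntegral ((T.X n).residueField ((T.π n).base (pt (n + 1)))) ((T.X (n + 1)).residueField (pt (n + 1))) :=
      ⟨isIntegral_residueFieldMap_of_isIsoPointTower hT n⟩
    haveI : PerfectField ((T.X n).residueField ((T.π n).base (pt (n + 1)))) := by
      have h := hperf n
      rw [← hT.2.1 n] at h
      exact h
    exact Algebra.IsAlgebraic.isSeparable_of_perfectField
  have hev : ∃ n₀, ∀ n, n₀ ≤ n → ¬ IsInsepStage T pt n :=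
    ⟨0, fun n _ => forall_not_isInsepStage_of_perfectField_origin hT (hperf 0) n⟩
  have hsat := IsoTailsHS.satelliteRecurrent_of_isIsoPointTower_of_separableSteps f hO hT φ₀ hφ₀ hsep₀ hsep
  exact h3 ν T pt hO hT hev hsat

/-- **CENSUS FORM**: K3-sep ALONE gives the kernel `IsoQuadraticTowerTerminates p 3` on every tower whose origin stage is of finite type over a
perfect field of characteristic `p` (finite fields, algebraic closures of `𝔽_p`, …). [cite: CossartPiltant2009, ch. 4 II.4] -/
theorem not_isIsoPointTower_over_perfectField_of_K3sep (h3 : IsoSepSatelliteRecurrentImpossible.{u} p 3)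
    {k : Type u} [Field k] [CharP k p] [PerfectField k] (f : T.X 0 ⟶ Spec (.of k)) [IsSeparated f] [LocallyOfFiniteType f] [QuasiCompact f]
    (hO : IsMaximalOrigin p 3 ν (T.X 0) (pt 0)) : ¬ IsIsoPointTower 3 ν T pt :=
  fun hT => false_of_isIsoPointTower_over_perfectField_of_K3sep h3 f hO hT

end Summit.ResolutionOfSingularities.ResolutionOfSingularities.Cruxes.SigmaMaxModifications.IdeasL1C5

end
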